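import Summits.CriticalPhenomena.PercolationContinuityZ3.Theorems.PercNearOneGluingNoHeavyLowerTailSahiCombTriWCertGenBoundary

/-!
# The ANTIPODAL DUALITY of zeta relations: `ζf ≡ 0` on an up-set `W` iff `ζ*f ≡ 0` on `refl W` — and C1 as a one-line corollary

Support file of the one-cut programme (crux `NoHeavyLowerTail`, stmt-CriticalPhenomena-4575; cell `prim-masterthm`, seat P5 gen 20; memo
`FROM-prim-masterthm-p5-g20-COMBO1.md` §4).  Tool for the kernel eliminations of the rank route (`…FiveUpSetRank`, `…TriWCertGen*`,
`…TriWQZetaRank`): every elimination so far expands zeta relations `Σ_d f d [d ⊆ u] = 0 (u ∈ W)` in the ANTIPODAL BASIS of `ℚ^W`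
(support lemma + C1, by induction).  The same information is carried, linearly and invertibly, by the DUAL ZETA sums
`ζ*f(e) = Σ_d f d [e ⊆ d]` on the antipodal family `refl W = {e | eᶜ ∈ W}`:

  `ζ*f(e) = Σ_{s ⊆ e} (−1)^{#s} · ζf(sᶜ)`      and      `ζf(u) = Σ_{s ⊆ uᶜ} (−1)^{#s} · ζ*f(s)`

(both from `[e ⊆ d] = Σ_{s ⊆ e \ d} (−1)^{#s}`), and for `e ∈ refl W` every `sᶜ ⊇ eᶜ` lies in the up-set `W`, while for `u ∈ W` every
`s ⊆ uᶜ` lies in the down-set `refl W`.  Hence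

* **`FiveUpSet.zeta_sum_eq_zero_iff_dual`**: for an up-set `W`, `(∀ u ∈ W, Σ_d f d [d ⊆ u] = 0) ↔ (∀ e ∈ refl W, Σ_d f d [e ⊆ d] = 0)`.
In the dual form the single-block kernel facts are immediate "maximal support element" statements:
* `FiveUpSet.eq_zero_of_dual_zeta_sum_eq_zero_of_support` — a dual zeta relation on a family containing the support forces `f = 0`
  (at a support point of MAXIMAL cardinality the relation reads `f u = 0`; mirror of `eq_zero_of_zeta_sum_eq_zero_of_support`);
* (remark, not restated here) C1 = `eq_zero_of_zeta_sum_eq_zero` of `…FiveUpSetRank` follows in one line: `supp f ⊆ refl W`, `ζf ≡ 0` on `W`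
  ⇒ `ζ*f ≡ 0` on `refl W ⊇ supp f` ⇒ `f = 0`; the translate-rank lemma TR has the same shape with the partial dual zeta `Σ_{d ⊇ e, d ∩ s = e ∩ s}`.
Also the two conversion identities `dualZeta_eq_alt_sum_zeta`, `zeta_eq_alt_sum_dualZeta` (any `f`, any point).
HONEST LABEL: elementary linear algebra on the cube, fully proved, std axioms; no new facts about `TriWIneq`. [this work]
-/

namespace Summit.CriticalPhenomena.PercolationContinuityZ3.Theorems

namespace FiveUpSet

open Finset

variable {α : Type} [DecidableEq α] [Fintype α]

/-! ### Two signed-powerset identities -/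

omit [Fintype α] in
/-- `Σ_{s ⊆ e} (−1)^{#s} [d ⊆ sᶜ] = [e ⊆ d]`: the terms with `s` meeting `d` vanish, and `Σ_{s ⊆ e \ d} (−1)^{#s} = [e \ d = ∅]`. [folklore] -/
theorem sum_powerset_neg_one_pow_card_subset_compl [Fintype α] (d e : Finset α) :
    ∑ s ∈ e.powerset, (-1 : ℚ) ^ s.card * (if d ⊆ sᶜ then (1 : ℚ) else 0) = if e ⊆ d then 1 else 0 := by
  have hf : (e \ d).powerset = e.powerset.filter (fun s => d ⊆ sᶜ) := by
    ext s
    simp only [mem_powerset, mem_filter]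
    constructor
    · intro h
      exact ⟨fun x hx => (mem_sdiff.1 (h hx)).1, fun x hxd => mem_compl.2 (fun hxs => (mem_sdiff.1 (h hxs)).2 hxd)⟩
    · rintro ⟨hse, hds⟩ x hxs
      exact mem_sdiff.2 ⟨hse hxs, fun hxd => (mem_compl.1 (hds hxd)) hxs⟩
  simp_rw [mul_boole]
  rw [← Finset.sum_filter, ← hf, sum_powerset_neg_one_pow_card_rat (e \ d)]
  by_cases h : e ⊆ d
  · rw [if_pos h, if_pos (Finset.sdiff_eq_empty_iff_subset.2 h)]
  · rw [if_neg h, if_neg (fun h' => h (Finset.sdiff_eq_empty_iff_subset.1 h'))]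

/-- **Dual zeta through zeta**: `Σ_d f d [e ⊆ d] = Σ_{s ⊆ e} (−1)^{#s} · (Σ_d f d [d ⊆ sᶜ])` for every `f` and `e`. [this work] -/
theorem dualZeta_eq_alt_sum_zeta (f : Finset α → ℚ) (e : Finset α) :
    ∑ d, f d * (if e ⊆ d then (1 : ℚ) else 0)
      = ∑ s ∈ e.powerset, (-1 : ℚ) ^ s.card * ∑ d, f d * (if d ⊆ sᶜ then (1 : ℚ) else 0) := by
  calc ∑ d, f d * (if e ⊆ d then (1 : ℚ) else 0)
      = ∑ d, f d * ∑ s ∈ e.powerset, (-1 : ℚ) ^ s.card * (if d ⊆ sᶜ then (1 : ℚ) else 0) := by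
        refine sum_congr rfl fun d _ => ?_
        rw [sum_powerset_neg_one_pow_card_subset_compl d e]
    _ = ∑ d, ∑ s ∈ e.powerset, (-1 : ℚ) ^ s.card * (f d * (if d ⊆ sᶜ then (1 : ℚ) else 0)) := by
        refine sum_congr rfl fun d _ => ?_
        rw [Finset.mul_sum]
        refine sum_congr rfl fun s _ => ?_
        ring
    _ = ∑ s ∈ e.powerset, ∑ d, (-1 : ℚ) ^ s.card * (f d * (if d ⊆ sᶜ then (1 : ℚ) else 0)) := Finset.sum_comm
    _ = ∑ s ∈ e.powerset, (-1 : ℚ) ^ s.card * ∑ d, f d * (if d ⊆ sᶜ then (1 : ℚ) else 0) := by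
        refine sum_congr rfl fun s _ => ?_
        rw [Finset.mul_sum]

/-- **Zeta through dual zeta**: `Σ_d f d [d ⊆ u] = Σ_{s ⊆ uᶜ} (−1)^{#s} · (Σ_d f d [s ⊆ d])` for every `f` and `u`
(from `Σ_{s ⊆ uᶜ} (−1)^{#s} [s ⊆ d] = [uᶜ ∩ d = ∅] = [d ⊆ u]`, `sum_powerset_neg_one_pow_card_zeta`). [this work] -/
theorem zeta_eq_alt_sum_dualZeta (f : Finset α → ℚ) (u : Finset α) :
    ∑ d, f d * (if d ⊆ u then (1 : ℚ) else 0)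
      = ∑ s ∈ uᶜ.powerset, (-1 : ℚ) ^ s.card * ∑ d, f d * (if s ⊆ d then (1 : ℚ) else 0) := by
  have key : ∀ d : Finset α, (if d ⊆ u then (1 : ℚ) else 0)
      = ∑ s ∈ uᶜ.powerset, (-1 : ℚ) ^ s.card * (if s ⊆ d then (1 : ℚ) else 0) := by
    intro d
    rw [sum_powerset_neg_one_pow_card_zeta uᶜ d]
    have hiff : uᶜ ∩ d = ∅ ↔ d ⊆ u := by
      constructor
      · intro h x hx
        by_contra hxu
        have : x ∈ uᶜ ∩ d := mem_inter.2 ⟨mem_compl.2 hxu, hx⟩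
        rw [h] at this
        simp at this
      · intro h
        ext x
        simp only [mem_inter, mem_compl, Finset.notMem_empty, iff_false, not_and]
        exact fun hxu hxd => hxu (h hxd)
    by_cases h : d ⊆ u
    · rw [if_pos h, if_pos (hiff.2 h)]
    · rw [if_neg h, if_neg (fun h' => h (hiff.1 h'))]
  calc ∑ d, f d * (if d ⊆ u then (1 : ℚ) else 0)
      = ∑ d, f d * ∑ s ∈ uᶜ.powerset, (-1 : ℚ) ^ s.card * (if s ⊆ d then (1 : ℚ) else 0) := by
        refine sum_congr rfl fun d _ => ?_
        rw [key d]
    _ = ∑ d, ∑ s ∈ uᶜ.powerset, (-1 : ℚ) ^ s.card * (f d * (if s ⊆ d then (1 : ℚ) else 0)) := by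
        refine sum_congr rfl fun d _ => ?_
        rw [Finset.mul_sum]
        refine sum_congr rfl fun s _ => ?_
        ring
    _ = ∑ s ∈ uᶜ.powerset, ∑ d, (-1 : ℚ) ^ s.card * (f d * (if s ⊆ d then (1 : ℚ) else 0)) := Finset.sum_comm
    _ = ∑ s ∈ uᶜ.powerset, (-1 : ℚ) ^ s.card * ∑ d, f d * (if s ⊆ d then (1 : ℚ) else 0) := by
        refine sum_congr rfl fun s _ => ?_
        rw [Finset.mul_sum]

/-! ### The duality -/

/-- **ANTIPODAL DUALITY OF ZETA RELATIONS.**  For an up-set `W` of the cube and any `f`: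
`Σ_d f d [d ⊆ u] = 0` for all `u ∈ W`  iff  `Σ_d f d [e ⊆ d] = 0` for all `e ∈ refl W` (i.e. all `e` with `eᶜ ∈ W`).
(`→`: for `eᶜ ∈ W` every `sᶜ`, `s ⊆ e`, is `⊇ eᶜ`, hence in `W`; `←`: for `u ∈ W` every `s ⊆ uᶜ` has `sᶜ ⊇ u`, hence `s ∈ refl W`.) [this work] -/
theorem zeta_sum_eq_zero_iff_dual {W : Finset (Finset α)} (hW : IsUpperSet (W : Set (Finset α))) (f : Finset α → ℚ) :
    (∀ u ∈ W, ∑ d, f d * (if d ⊆ u then (1 : ℚ) else 0) = 0) ↔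
      (∀ e ∈ refl W, ∑ d, f d * (if e ⊆ d then (1 : ℚ) else 0) = 0) := by
  constructor
  · intro h e he
    rw [mem_refl] at he
    rw [dualZeta_eq_alt_sum_zeta f e]
    refine Finset.sum_eq_zero fun s hs => ?_
    have hsW : sᶜ ∈ W := by
      refine hW ?_ he
      intro x hx
      rw [mem_compl] at hx ⊢
      exact fun hxs => hx (mem_powerset.1 hs hxs)
    rw [h sᶜ hsW, mul_zero]
  · intro h u hu
    rw [zeta_eq_alt_sum_dualZeta f u]
    refine Finset.sum_eq_zero fun s hs => ?_
    have hsW : s ∈ refl W := by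
      rw [mem_refl]
      refine hW ?_ hu
      intro x hx
      rw [mem_compl]
      intro hxs
      have := mem_powerset.1 hs hxs
      rw [mem_compl] at this
      exact this hx
    rw [h s hsW, mul_zero]

/-! ### Corollaries: support arguments in the dual form -/

/-- A DUAL zeta relation on a family containing the support forces zero: if `f d ≠ 0 → d ∈ U` and `Σ_d f d [u ⊆ d] = 0` for every `u ∈ U`,
then `f = 0` — at a support point of MAXIMAL cardinality the relation reads `f u = 0`. [this work] -/
theorem eq_zero_of_dual_zeta_sum_eq_zero_of_support (U : Finset (Finset α)) (f : Finset α → ℚ) (hf : ∀ d, f d ≠ 0 → d ∈ U)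
    (h : ∀ u ∈ U, ∑ d, f d * (if u ⊆ d then (1 : ℚ) else 0) = 0) : ∀ d, f d = 0 := by
  by_contra hne
  push Not at hne
  set T := (univ : Finset (Finset α)).filter (fun d => f d ≠ 0) with hT
  have hTne : T.Nonempty := by
    obtain ⟨d, hd⟩ := hne
    exact ⟨d, mem_filter.2 ⟨mem_univ d, hd⟩⟩
  obtain ⟨u, huT, humax⟩ := exists_max_image T (fun d => d.card) hTne
  have hfu : f u ≠ 0 := (mem_filter.1 huT).2
  have hsum := h u (hf u hfu)
  rw [Finset.sum_eq_single u] at hsum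
  · simp only [Finset.Subset.refl, if_true, mul_one] at hsum
    exact hfu hsum
  · intro d _ hdu
    by_cases hsub : u ⊆ d
    · have hlt : u.card < d.card := card_lt_card (lt_of_le_of_ne hsub (Ne.symm hdu))
      by_cases hfd : f d = 0
      · rw [hfd, zero_mul]
      · exact absurd (humax d (mem_filter.2 ⟨mem_univ d, hfd⟩)) (not_le.2 hlt)
    · rw [if_neg hsub, mul_zero]
  · intro hu
    exact absurd (mem_univ u) hu

end FiveUpSet

end Summit.CriticalPhenomena.PercolationContinuityZ3.Theorems
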